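import Literature.NumberTheory.LFunctions.VinogradovKorobovNumerics
import Mathlib.Analysis.Convolution
import Mathlib.Analysis.SpecialFunctions.Integrals.Basic
import Mathlib.MeasureTheory.Measure.Lebesgue.Integral

/-!
# Ford's smoothing kernel, its Laplace transform, and Lemma 6.1 of Mossinghoff–Trudgian–Yang from its zero-detector core

Topic `Literature/NumberTheory/LFunctions`. Part of the decomposition of
`Literature.NumberTheory.LFunctions.zero_free_region_vinogradov_korobov` (rh.S10 =
Mossinghoff–Trudgian–Yang, *Res. Number Theory* 10 (2024) = arXiv:2212.06867, Thm. 1.1; arXiv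
numbering throughout; architecture in `VinogradovKorobov.lean`). It concerns the named fact
`Literature.NumberTheory.LFunctions.zero_inequality_intermediate_mossinghoff_trudgian_yang`
(**Lemma 6.1** of the source, `VinogradovKorobovInputs.lean`), from which Theorem 1.4 is proved in
`VinogradovKorobovIntermediate.lean`. Everything in this file is PROVED; no named fact is
introduced.

## What is here

The printed proof of Lemma 6.1 (§6, (6.2)–(6.11)) has two layers.

* A **ζ-analytic core** — inequality **(6.8)** with its sum `(cπ²λf(0) − 4D) Σ_j b_j N(jt, ½)`
  dropped by **(6.9)**: Ford's mollified zero detector (Lemma 4.2, `η = 1/2`, `D = 1.0146 λ f(0)`)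
  summed against the non-negative trigonometric polynomial `P₄₀`, with Patel's sub-Weyl bound
  (3.3) fed through Lemma 4.3, the bound `0.851 b₀` for the `3/2`-line integral, the far-zero
  bound (6.4) (Ford 2002, (9.1), resting on an explicit `N(T)` theorem) and the near-zero bounds
  (6.5)–(6.7) (maximum modulus for Ford's `V_c`). This layer rests on Patel's thesis bound (3.3)
  (`zeta_half_line_patel`) and an explicit Riemann–von Mangoldt formula
  (`zetaZeroCount_hasanalizade_shen_wong`), both unproved named facts of the tree, and on Ford's
  Lemmas 2.1–5.1; it is NOT formalised here. It enters below only as the HYPOTHESIS `hZ` of the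
  reduction theorems, transcribed verbatim as `0 ≤ mtyDetectorRHS θ β t λ` (a real-valued
  bookkeeping definition of the right-hand side of (6.8) without the dropped sum).
* A **kernel layer** — the final steps (6.10)–(6.11) and the roundings: the identity
  `b₀F(0) − b₁F(1−β) = b₁(W(0) − W(X)) − b₀f(0)cos²θ/λ` (`X = (1−β)/λ − 1`), which needs the
  closed forms of `W(0)`, `W(−1)` (Ford 2002, (6.5); Heath-Brown 1992, Lemma 7.1) and `w(0)`
  ((4.3)) for Heath-Brown's kernel `w = g ∗ g`, `g(u) = (cos(u tan θ) − cos θ)sec²θ` on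
  `|u| ≤ θ cot θ`; the bound `W(0) − W(X) ≤ X |W'(0)|` with `W'(0)` given by (4.6); and the
  numerical constants `0.17949 ≤ cos²θ`, `0.20466 ≥ |W'(0)|b₁/(w(0)b₀)`, `5.746`, `3.5691`,
  `18.439`. **This layer is proved here in full**, for the kernel DEFINED in Lean
  (`fordKernelG`, `fordKernelW := g ⋆ g` (Mathlib convolution), `fordLaplaceW θ x = ∫₀^∞ e^{−xu}
  w(u) du`, `fordKernelMoment θ = ∫₀^∞ u w(u) du`):
  - `fordKernelW_zero` : `w(0) = fordSmoothW0 θ` — formula **(4.3)**;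
  - `fordLaplaceW_zero` : `W(0) = 2 sec²θ (1 − θ cot θ)²` — Ford (6.5);
  - `fordKernelW_eq_explicit` : the kernel in closed form on `[0, 2θ cot θ]`
    (`fordKernelWExplicit`), and `fordKernelW_eq_zero` (support `⊆ [−2θ cot θ, 2θ cot θ]`);
  - `fordLaplaceW_neg_one` : `W(−1) = 1 + (2 − 3θ cot θ) sec²θ` — Ford's
    `2tan²θ + 3 − 3θ(tan θ + cot θ)` of (6.5) rewritten with `sin² + cos² = 1`;
  - `fordKernelMoment_eq` : `∫₀^∞ u w(u) du = −W'(0)` with `W'(0)` the closed form **(4.6)**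
    (`fordLaplaceWDeriv0`), i.e. (4.6) is verified against the kernel;
  - `fordLaplaceW_zero_sub_le` : `W(0) − W(X) ≤ X ∫₀^∞ u w(u) du` (from `1 − e^{−y} ≤ y`; the
    source's (6.11) via the mean value theorem and the monotonicity of `W'`);
  - `ford_W_identity` : `b₁W(0) − b₀W(−1) = b₀ w(0) cos²θ` for every solution `θ` of (4.1)
    (`IsFordTheta b₀ b₁ θ`) — the identity (6.10) / Ford (7.12);
  - `zero_inequality_intermediate_of_detector`, `…_of_detector'` : **Lemma 6.1 follows from the
    detector inequality (6.8)–(6.9) alone** (for the solution `θ ∈ [1.13331020, 1.13331021]` of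
    (4.1) supplied by `VK.exists_isFordTheta_mtyB40`, with the certified numerics of
    `VinogradovKorobovNumerics.lean`).

## Faithfulness notes

1. `mtyDetectorRHS` transcribes (6.8) with `f(0) = λ w(0)` ((4.4): `f(u) = λe^{λu}w(λu)`) and
   `F(z) = W(z/λ − 1)` (§4), so `F(1 − β) = W((1−β)/λ − 1)`, `F(0) = W(−1)`; `K = 40`,
   `(b₀, b₁, b) = (mtyB40 0, mtyB40 1, mtyB40Sum)` are the exact coefficients of `P₄₀` ((3.6)),
   `J = mtyJ` ((6.1)), `L₁ = log(40t + 1)`, `L₂ = log log(40t + 1)`, `D = 1.0146 λ f(0)`.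
2. **A slip in the printed proof, not affecting the statement.** (6.9) reads
   `cπ²λf(0) − 4D = [4 + π(1−β)H(R)/(w(0)(β − ½)²) − 4.0584]λf(0) ≤ 0` with
   `c := 4/π² + π(1−β)H(R)/(w(0)(π/2 − π(1−β))²)` (display before (6.6)). Numerically the bracket
   is `+0.117` at `1 − β = 1/1712` with the quoted `H(R) ≤ 134.87`, `w(0) ≥ 5.64531`, and still
   `+0.007` with the true `H(855) = 50.27…`; indeed `H(R) ≥ c₀c₃ = 49.74` for all `R`, so the
   printed bracket is positive at `1 − β = 1/1712` whatever bound for `H(R)` is used. The formula for `c` is copied from Ford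
   2002, §9, where it is also printed with a square, but Ford's derivation (§7, proof of
   `Re V_c(z) ≥ −c₅c²w(0)`: `Re V_c ≥ c²w(0)(−4/π² − H(R)c/(w(0)(π/2 − c)³))`, `c = πλ ≤ π(1−β)
   = π/(2(R+1))`) has a CUBE, giving `π²c = 4 + 4(R+1)²H(R)/(w(0)R³) = 4(C₅(R) − 1/R)` and Ford's
   exact "`π²c₅ − 4c₄ = −4/R < 0`". With this `c`, `cπ²λf(0) − 4D ≤ (4C₅(R) − 4/R − 4·1.0146)λf(0)
   < 0` since `C₅(R) ≤ C₅(855) = 1.0116… ≤ 1.0146` for `R = 1/(2(1−β)) − 1 ≥ 855`. So (6.8) with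
   the sum dropped — the hypothesis `hZ` — is what the (corrected) argument delivers, and Lemma 6.1
   as vendored stands.
3. The kernel objects are Lean definitions with bodies; the closed forms (4.3), (4.6), Ford (6.5)
   are THEOREMS about them (the source takes them from Maple / Heath-Brown). `W` is only needed at
   real arguments here; its values at complex arguments (needed to state Lemma 4.2 itself) are
   not introduced.
4. Sizes for the record: the remaining hypothesis `hZ` is the whole of Ford's method plus two
   printed inputs that are research-level explicit computations; see the NOTES of this unit for
   the dependency graph (Lemma 4.1 = Ford L2.2 zero detector via the Hadamard product; Lemma 4.2;
   Lemma 4.3 = Ford L3.4; Ford L5.1 and `Σ Λ(n)/(n² − n) ≤ 0.851`; (6.4) from `N(T)`; (6.5)–(6.7)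
   from `Re W ≥ 0` on `Re z ≥ 0` and `|W₀(z)| ≤ H(R)/|z|³`, (4.5)).

## References

* M. J. Mossinghoff, T. S. Trudgian, A. Yang, *Explicit zero-free regions for the Riemann
  zeta-function*, Res. Number Theory 10 (2024), no. 11 = arXiv:2212.06867: §4 ((4.1)–(4.7),
  Lemmas 4.2, 4.3), §6 ((6.1), Lemma 6.1 and its proof, (6.2)–(6.11))
  (`MossinghoffTrudgianYangRNT2024`).
* K. Ford, *Zero-free regions for the Riemann zeta function*, in Number Theory for the Millennium
  II (Urbana, IL, 2000), A K Peters 2002, 25–56 = arXiv:1910.08205: (6.2)–(6.5), Lemma 7.1 and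
  (7.12), §9 ((9.1), Lemma 9.2) (`Ford2002Millennium`).
* D. R. Heath-Brown, *Zero-free regions for Dirichlet L-functions, and the least prime in an
  arithmetic progression*, Proc. LMS 64 (1992), Lemmas 7.1, 7.5 (the kernel `g`).
-/

noncomputable section

open Real MeasureTheory Set Filter
open scoped Convolution Topology

namespace Literature.NumberTheory.LFunctions

/-! ## Ford's smoothing kernel `g`, `w = g ∗ g`, `W` (MTY §4; Ford 2002, §6; Heath-Brown 1992, Lemma 7.5) -/

/-- Heath-Brown's function `g(u) = (cos(u tan θ) − cos θ) sec²θ` for `|u| ≤ θ cot θ`, `0` otherwise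
(Mossinghoff–Trudgian–Yang, display after (4.2); Ford 2002, (6.3)).
[cite: MossinghoffTrudgianYangRNT2024, §4 (definition of g)] -/
def fordKernelG (θ u : ℝ) : ℝ :=
  if |u| ≤ θ * Real.cot θ then (Real.cos (u * Real.tan θ) - Real.cos θ) / Real.cos θ ^ 2 else 0

/-- The smoothing kernel `w = g ∗ g`, `w(u) = ∫ g(t) g(u − t) dt` (MTY, display after (4.2); Ford
2002, §6). [cite: MossinghoffTrudgianYangRNT2024, §4 (definition of w)] -/
def fordKernelW (θ : ℝ) : ℝ → ℝ :=
  fordKernelG θ ⋆ fordKernelG θ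

/-- The Laplace transform `W(x) = ∫₀^∞ e^{−xu} w(u) du` of `w`, at real arguments (MTY §4; Ford
2002, §6). [cite: MossinghoffTrudgianYangRNT2024, §4 (definition of W)] -/
def fordLaplaceW (θ x : ℝ) : ℝ :=
  ∫ u in Ioi (0 : ℝ), Real.exp (-(x * u)) * fordKernelW θ u

/-- The first moment `∫₀^∞ u w(u) du` of `w`; it equals `−W'(0) = |W'(0)|` (MTY (4.6) gives the
closed form of `W'(0)`). [cite: MossinghoffTrudgianYangRNT2024, (4.6)] -/
def fordKernelMoment (θ : ℝ) : ℝ :=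
  ∫ u in Ioi (0 : ℝ), u * fordKernelW θ u

/-! ### Elementary properties of `g` -/

/-- Unfolding lemma for `g`. [folklore] -/
theorem fordKernelG_def (θ u : ℝ) : fordKernelG θ u =
    if |u| ≤ θ * Real.cot θ then (Real.cos (u * Real.tan θ) - Real.cos θ) / Real.cos θ ^ 2
    else 0 := rfl

/-- `g` on its support interval. [folklore] -/
theorem fordKernelG_of_abs_le {θ u : ℝ} (h : |u| ≤ θ * Real.cot θ) :
    fordKernelG θ u = (Real.cos (u * Real.tan θ) - Real.cos θ) / Real.cos θ ^ 2 := by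
  simp [fordKernelG, h]

/-- `g` vanishes off `[−θ cot θ, θ cot θ]`. [folklore] -/
theorem fordKernelG_of_lt_abs {θ u : ℝ} (h : θ * Real.cot θ < |u|) : fordKernelG θ u = 0 := by
  simp [fordKernelG, not_le.2 h]

/-- `g` is even. [folklore] -/
theorem fordKernelG_neg (θ u : ℝ) : fordKernelG θ (-u) = fordKernelG θ u := by
  simp [fordKernelG, abs_neg, neg_mul, Real.cos_neg]

section theta

variable {θ : ℝ} (hθ₀ : 0 < θ) (hθ₁ : θ < π / 2)
include hθ₀ hθ₁

/-- `cos θ > 0` on `(0, π/2)`. [folklore] -/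
theorem ford_cos_pos : 0 < Real.cos θ :=
  Real.cos_pos_of_mem_Ioo ⟨by linarith, hθ₁⟩

/-- `sin θ > 0` on `(0, π/2)`. [folklore] -/
theorem ford_sin_pos : 0 < Real.sin θ :=
  Real.sin_pos_of_pos_of_lt_pi hθ₀ (by linarith [Real.pi_pos])

/-- `tan θ > 0` on `(0, π/2)`. [folklore] -/
theorem ford_tan_pos : 0 < Real.tan θ := by
  rw [Real.tan_eq_sin_div_cos]; exact div_pos (ford_sin_pos hθ₀ hθ₁) (ford_cos_pos hθ₀ hθ₁)

/-- `(θ cot θ) tan θ = θ`. [folklore] -/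
theorem ford_cot_mul_tan : θ * Real.cot θ * Real.tan θ = θ := by
  rw [Real.cot_eq_cos_div_sin, Real.tan_eq_sin_div_cos]
  field_simp [(ford_sin_pos hθ₀ hθ₁).ne', (ford_cos_pos hθ₀ hθ₁).ne']

/-- `θ cot θ > 0` on `(0, π/2)`. [folklore] -/
theorem ford_cot_pos : 0 < θ * Real.cot θ := by
  rw [Real.cot_eq_cos_div_sin]
  exact mul_pos hθ₀ (div_pos (ford_cos_pos hθ₀ hθ₁) (ford_sin_pos hθ₀ hθ₁))

/-- `g ≥ 0`: for `|u| ≤ θ cot θ` one has `|u tan θ| ≤ θ < π/2`, so `cos(u tan θ) ≥ cos θ`.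
[cite: MossinghoffTrudgianYangRNT2024, §4 ("f(u) ≥ 0 since g(u) ≥ 0")] -/
theorem fordKernelG_nonneg (u : ℝ) : 0 ≤ fordKernelG θ u := by
  unfold fordKernelG
  split_ifs with h
  · apply div_nonneg _ (sq_nonneg _)
    rw [sub_nonneg]
    have h1 : |u * Real.tan θ| ≤ θ := by
      rw [abs_mul, abs_of_pos (ford_tan_pos hθ₀ hθ₁)]
      calc |u| * Real.tan θ ≤ θ * Real.cot θ * Real.tan θ :=
            mul_le_mul_of_nonneg_right h (ford_tan_pos hθ₀ hθ₁).le
        _ = θ := ford_cot_mul_tan hθ₀ hθ₁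
    rw [← Real.cos_abs (u * Real.tan θ)]
    exact Real.cos_le_cos_of_nonneg_of_le_pi (abs_nonneg _) (by linarith [Real.pi_pos])
      h1
  · exact le_rfl

/-- `g` is continuous (the two branches agree at `|u| = θ cot θ`, where `cos(u tan θ) = cos θ`).
[folklore] -/
theorem continuous_fordKernelG : Continuous (fordKernelG θ) := by
  unfold fordKernelG
  refine Continuous.if_le (by fun_prop) continuous_const (by fun_prop) continuous_const ?_
  intro u hu
  have : Real.cos (u * Real.tan θ) = Real.cos θ := by
    rw [← Real.cos_abs, abs_mul, abs_of_pos (ford_tan_pos hθ₀ hθ₁), hu, ford_cot_mul_tan hθ₀ hθ₁]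
  simp [this]

omit hθ₀ hθ₁ in
/-- `g` is supported in `[−θ cot θ, θ cot θ]`. [folklore] -/
theorem support_fordKernelG_subset :
    Function.support (fordKernelG θ) ⊆ Icc (-(θ * Real.cot θ)) (θ * Real.cot θ) := by
  intro u hu
  rw [Function.mem_support] at hu
  by_contra h
  apply hu
  apply fordKernelG_of_lt_abs
  rw [mem_Icc, ← abs_le] at h
  exact not_le.1 h

omit hθ₀ hθ₁ in
/-- `g` has compact support. [folklore] -/
theorem hasCompactSupport_fordKernelG : HasCompactSupport (fordKernelG θ) :=
  HasCompactSupport.of_support_subset_isCompact isCompact_Icc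
    support_fordKernelG_subset

/-- `g` is integrable. [folklore] -/
theorem integrable_fordKernelG : Integrable (fordKernelG θ) :=
  (continuous_fordKernelG hθ₀ hθ₁).integrable_of_hasCompactSupport hasCompactSupport_fordKernelG

/-- `|g| ≤ sec²θ`… a crude bound: `0 ≤ g ≤ (1 − cos θ)/cos²θ ≤ 1/cos²θ`. [folklore] -/
theorem fordKernelG_le (u : ℝ) : fordKernelG θ u ≤ 1 / Real.cos θ ^ 2 := by
  unfold fordKernelG
  split_ifs with h
  · apply div_le_div_of_nonneg_right _ (sq_nonneg _)
    linarith [Real.cos_le_one (u * Real.tan θ), (ford_cos_pos hθ₀ hθ₁).le]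
  · positivity

/-! ### Elementary properties of `w = g ∗ g` -/

omit hθ₀ hθ₁ in
/-- `w(u) = ∫ g(t) g(u − t) dt`. [cite: MossinghoffTrudgianYangRNT2024, §4 (definition of w)] -/
theorem fordKernelW_apply (u : ℝ) :
    fordKernelW θ u = ∫ t, fordKernelG θ t * fordKernelG θ (u - t) := by
  simp [fordKernelW, convolution_def]

/-- `w ≥ 0`. [cite: MossinghoffTrudgianYangRNT2024, §4] -/
theorem fordKernelW_nonneg (u : ℝ) : 0 ≤ fordKernelW θ u := by
  rw [fordKernelW_apply]
  exact integral_nonneg fun t ↦ mul_nonneg (fordKernelG_nonneg hθ₀ hθ₁ t)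
    (fordKernelG_nonneg hθ₀ hθ₁ _)

/-- `w` is continuous (convolution of a locally integrable with a continuous compactly supported
function). [folklore] -/
theorem continuous_fordKernelW : Continuous (fordKernelW θ) :=
  (hasCompactSupport_fordKernelG (θ := θ)).continuous_convolution_right _
    (integrable_fordKernelG hθ₀ hθ₁).locallyIntegrable (continuous_fordKernelG hθ₀ hθ₁)

omit hθ₀ hθ₁ in
/-- `w` has compact support. [folklore] -/
theorem hasCompactSupport_fordKernelW : HasCompactSupport (fordKernelW θ) :=
  (hasCompactSupport_fordKernelG (θ := θ)).convolution _ hasCompactSupport_fordKernelG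

/-- `w` is integrable. [folklore] -/
theorem integrable_fordKernelW : Integrable (fordKernelW θ) :=
  (continuous_fordKernelW hθ₀ hθ₁).integrable_of_hasCompactSupport hasCompactSupport_fordKernelW

omit hθ₀ hθ₁ in
/-- `w` is even. [folklore] -/
theorem fordKernelW_neg (u : ℝ) : fordKernelW θ (-u) = fordKernelW θ u :=
  convolution_neg_of_neg_eq _ (Eventually.of_forall (fordKernelG_neg θ))
    (Eventually.of_forall (fordKernelG_neg θ))

/-- `u ↦ φ(u) w(u)` is integrable for continuous `φ` (compact support). [folklore] -/
theorem integrable_mul_fordKernelW {φ : ℝ → ℝ} (hφ : Continuous φ) :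
    Integrable (fun u ↦ φ u * fordKernelW θ u) :=
  ((hφ.mul (continuous_fordKernelW hθ₀ hθ₁)).integrable_of_hasCompactSupport
    hasCompactSupport_fordKernelW.mul_left)

/-! ### `W` is positive-decreasing-convex: the one inequality Lemma 6.1 needs -/

/-- `W(0) − W(X) ≤ X ∫₀^∞ u w(u) du` (from `1 − e^{−Xu} ≤ Xu` and `w ≥ 0`; convexity of `W`); the source
obtains this from the mean value theorem and the monotonicity of `W'` ((6.11)).
[cite: MossinghoffTrudgianYangRNT2024, (6.11)] -/
theorem fordLaplaceW_zero_sub_le (X : ℝ) :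
    fordLaplaceW θ 0 - fordLaplaceW θ X ≤ X * fordKernelMoment θ := by
  unfold fordLaplaceW fordKernelMoment
  have hi0 : IntegrableOn (fun u ↦ Real.exp (-(0 * u)) * fordKernelW θ u) (Ioi 0) :=
    (integrable_mul_fordKernelW hθ₀ hθ₁ (by fun_prop)).integrableOn
  have hiX : IntegrableOn (fun u ↦ Real.exp (-(X * u)) * fordKernelW θ u) (Ioi 0) :=
    (integrable_mul_fordKernelW hθ₀ hθ₁ (by fun_prop)).integrableOn
  have him : IntegrableOn (fun u ↦ u * fordKernelW θ u) (Ioi 0) :=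
    (integrable_mul_fordKernelW hθ₀ hθ₁ continuous_id).integrableOn
  rw [← integral_sub hi0 hiX, ← integral_const_mul]
  refine setIntegral_mono_on (hi0.sub hiX) (him.const_mul X) measurableSet_Ioi ?_
  intro u hu
  have hw := fordKernelW_nonneg hθ₀ hθ₁ u
  have h1 : Real.exp (-(0 * u)) = 1 := by simp
  rw [h1, ← sub_mul, ← mul_assoc]
  apply mul_le_mul_of_nonneg_right _ hw
  have := Real.add_one_le_exp (-(X * u))
  linarith

end theta

/-- The algebra of `w(0)`: the evaluated integral `∫ g²` equals the closed form (4.3). [folklore] -/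
theorem fordSmoothW0_algebra {s c θ : ℝ} (hs : s ≠ 0) (hc : c ≠ 0) (h : s ^ 2 + c ^ 2 = 1) :
    (θ * c / s + c ^ 2 - 4 * c ^ 2 + 2 * θ * c ^ 3 / s) / c ^ 4
      = (θ * (s / c) + 3 * θ * (c / s) - 3) / c ^ 2 := by
  field_simp
  linear_combination (-θ) * h

section closedforms

variable {θ : ℝ} (hθ₀ : 0 < θ) (hθ₁ : θ < π / 2)
include hθ₀ hθ₁

/-! ### Closed forms: `∫ g`, `w(0)` ((4.3) of the source) and `W(0)` (Ford 2002, (6.5)) -/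

/-- `∫ g = 2 (1 − θ cot θ) sec θ`. [cite: Ford2002Millennium, (6.5) (W(0) = 2 sec²θ (1 − θ cot θ)²)] -/
theorem integral_fordKernelG :
    ∫ t, fordKernelG θ t = 2 * (1 - θ * Real.cot θ) / Real.cos θ := by
  have ha := ford_cot_pos hθ₀ hθ₁
  have hc := ford_cos_pos hθ₀ hθ₁
  have hs := ford_sin_pos hθ₀ hθ₁
  have hT := ford_tan_pos hθ₀ hθ₁
  have haT : θ * Real.cot θ * Real.tan θ = θ := ford_cot_mul_tan hθ₀ hθ₁
  rw [← setIntegral_eq_integral_of_forall_compl_eq_zero (s := Icc (-(θ * Real.cot θ)) (θ * Real.cot θ))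
      (fun t ht ↦ fordKernelG_of_lt_abs (by rwa [mem_Icc, ← abs_le, not_le] at ht)),
    integral_Icc_eq_integral_Ioc, ← intervalIntegral.integral_of_le (by linarith)]
  have hderiv : ∀ x ∈ uIcc (-(θ * Real.cot θ)) (θ * Real.cot θ),
      HasDerivAt (fun t ↦ (Real.sin (t * Real.tan θ) / Real.tan θ - Real.cos θ * t) / Real.cos θ ^ 2)
        (fordKernelG θ x) x := by
    intro x hx
    rw [uIcc_of_le (by linarith), mem_Icc, ← abs_le] at hx
    refine ((((hasDerivAt_mul_const (Real.tan θ)).sin.div_const (Real.tan θ)).fun_sub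
      (hasDerivAt_const_mul (Real.cos θ))).div_const (Real.cos θ ^ 2)).congr_deriv ?_
    rw [fordKernelG_of_abs_le hx]
    field_simp
  rw [intervalIntegral.integral_eq_sub_of_hasDerivAt hderiv
      ((continuous_fordKernelG hθ₀ hθ₁).intervalIntegrable _ _)]
  simp only [neg_mul, Real.sin_neg, haT]
  rw [Real.tan_eq_sin_div_cos] at hT ⊢
  rw [Real.cot_eq_cos_div_sin]
  field_simp
  ring

/-- **`w(0)` equals the closed form (4.3)**: `w(0) = ∫ g² = (θ tan θ + 3θ cot θ − 3) sec²θ =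
fordSmoothW0 θ`. [cite: MossinghoffTrudgianYangRNT2024, (4.3)] -/
theorem fordKernelW_zero : fordKernelW θ 0 = fordSmoothW0 θ := by
  have ha := ford_cot_pos hθ₀ hθ₁
  have hc := ford_cos_pos hθ₀ hθ₁
  have hs := ford_sin_pos hθ₀ hθ₁
  have hT := ford_tan_pos hθ₀ hθ₁
  have haT : θ * Real.cot θ * Real.tan θ = θ := ford_cot_mul_tan hθ₀ hθ₁
  rw [fordKernelW_apply]
  simp only [zero_sub, fordKernelG_neg]
  rw [← setIntegral_eq_integral_of_forall_compl_eq_zero (s := Icc (-(θ * Real.cot θ)) (θ * Real.cot θ))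
      (fun t ht ↦ by rw [fordKernelG_of_lt_abs (by rwa [mem_Icc, ← abs_le, not_le] at ht), zero_mul]),
    integral_Icc_eq_integral_Ioc, ← intervalIntegral.integral_of_le (by linarith)]
  have hderiv : ∀ x ∈ uIcc (-(θ * Real.cot θ)) (θ * Real.cot θ),
      HasDerivAt (fun t ↦ (t / 2 + Real.sin (2 * (t * Real.tan θ)) / (4 * Real.tan θ)
          - 2 * Real.cos θ * Real.sin (t * Real.tan θ) / Real.tan θ + Real.cos θ ^ 2 * t) / Real.cos θ ^ 4)
        (fordKernelG θ x * fordKernelG θ x) x := by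
    intro x hx
    rw [uIcc_of_le (by linarith), mem_Icc, ← abs_le] at hx
    refine ((((((hasDerivAt_id' x).div_const 2).fun_add
      ((((hasDerivAt_mul_const (Real.tan θ)).const_mul 2).sin).div_const (4 * Real.tan θ))).fun_sub
      ((((hasDerivAt_mul_const (Real.tan θ)).sin).const_mul (2 * Real.cos θ)).div_const
        (Real.tan θ))).fun_add
      (hasDerivAt_const_mul (Real.cos θ ^ 2))).div_const (Real.cos θ ^ 4)).congr_deriv ?_
    rw [fordKernelG_of_abs_le hx, Real.cos_two_mul]
    field_simp
    ring
  rw [intervalIntegral.integral_eq_sub_of_hasDerivAt hderiv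
      (((continuous_fordKernelG hθ₀ hθ₁).mul (continuous_fordKernelG hθ₀ hθ₁)).intervalIntegrable _ _)]
  simp only [neg_mul, Real.sin_neg, haT, mul_neg]
  rw [Real.sin_two_mul]
  unfold fordSmoothW0
  rw [Real.tan_eq_sin_div_cos] at hT ⊢
  rw [Real.cot_eq_cos_div_sin]
  have key := fordSmoothW0_algebra (θ := θ) hs.ne' hc.ne' (Real.sin_sq_add_cos_sq θ)
  rw [← key]
  field_simp
  ring

/-- **`W(0) = 2 sec²θ (1 − θ cot θ)²`** (Ford 2002, (6.5); Heath-Brown 1992, Lemma 7.1):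
`W(0) = ∫₀^∞ w = ½ ∫ w = ½ (∫ g)²`. [cite: Ford2002Millennium, (6.5)] -/
theorem fordLaplaceW_zero :
    fordLaplaceW θ 0 = 2 * (1 - θ * Real.cot θ) ^ 2 / Real.cos θ ^ 2 := by
  have hc := ford_cos_pos hθ₀ hθ₁
  unfold fordLaplaceW
  simp only [zero_mul, neg_zero, Real.exp_zero, one_mul]
  have heven : (fun x ↦ fordKernelW θ |x|) = fordKernelW θ := by
    ext x
    rcases le_or_gt 0 x with h | h
    · rw [abs_of_nonneg h]
    · rw [abs_of_neg h, fordKernelW_neg]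
  have h2 : ∫ x, fordKernelW θ x = 2 * ∫ x in Ioi 0, fordKernelW θ x := by
    rw [← integral_comp_abs, heven]
  have hconv : ∫ x, fordKernelW θ x = (∫ t, fordKernelG θ t) * (∫ t, fordKernelG θ t) := by
    unfold fordKernelW
    rw [integral_convolution (ContinuousLinearMap.lsmul ℝ ℝ) (integrable_fordKernelG hθ₀ hθ₁)
      (integrable_fordKernelG hθ₀ hθ₁)]
    simp [ContinuousLinearMap.lsmul_apply]
  have : ∫ x in Ioi 0, fordKernelW θ x = (∫ x, fordKernelW θ x) / 2 := by linarith
  rw [this, hconv, integral_fordKernelG hθ₀ hθ₁]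
  field_simp

end closedforms

/-! ### The kernel in closed form on `[0, 2θ cot θ]` -/

/-- The explicit form of `w = g ∗ g` on `0 ≤ u ≤ 2θ cot θ` (obtained here by integrating
`g(t)g(u − t)` over `t ∈ [u − θ cot θ, θ cot θ]`; the source and Ford use it implicitly through
Maple's closed form (4.5) of `W`):
`c⁴ w(u) = (θ cot θ − c² − u/2) cos(u tan θ) + (c(2c² + 1)/(2 sin θ)) sin(u tan θ)
+ c²(2θ cot θ − 2 − u)`, `c = cos θ`. [folklore] -/
def fordKernelWExplicit (θ u : ℝ) : ℝ :=
  ((θ * Real.cot θ - Real.cos θ ^ 2 - u / 2) * Real.cos (u * Real.tan θ)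
    + Real.cos θ * (2 * Real.cos θ ^ 2 + 1) / (2 * Real.sin θ) * Real.sin (u * Real.tan θ)
    + Real.cos θ ^ 2 * (2 * (θ * Real.cot θ) - 2 - u)) / Real.cos θ ^ 4

section explicit

variable {θ : ℝ} (hθ₀ : 0 < θ) (hθ₁ : θ < π / 2)
include hθ₀ hθ₁

/-- **`w` in closed form**: `w(u) = fordKernelWExplicit θ u` for `0 ≤ u ≤ 2θ cot θ`. [folklore] -/
theorem fordKernelW_eq_explicit {u : ℝ} (hu0 : 0 ≤ u) (hu : u ≤ 2 * (θ * Real.cot θ)) :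
    fordKernelW θ u = fordKernelWExplicit θ u := by
  have ha := ford_cot_pos hθ₀ hθ₁
  have hc := ford_cos_pos hθ₀ hθ₁
  have hs := ford_sin_pos hθ₀ hθ₁
  have hT := ford_tan_pos hθ₀ hθ₁
  have haT : θ * Real.cot θ * Real.tan θ = θ := ford_cot_mul_tan hθ₀ hθ₁
  have hcont := continuous_fordKernelG hθ₀ hθ₁
  rw [fordKernelW_apply]
  unfold fordKernelWExplicit
  rw [← setIntegral_eq_integral_of_forall_compl_eq_zero
      (s := Icc (u - θ * Real.cot θ) (θ * Real.cot θ)) ?_]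
  swap
  · intro t ht
    rw [mem_Icc, not_and_or, not_le, not_le] at ht
    rcases ht with h | h
    · rw [fordKernelG_of_lt_abs (θ := θ) (u := u - t) (by rw [abs_of_pos (by linarith)]; linarith),
        mul_zero]
    · rw [fordKernelG_of_lt_abs (θ := θ) (u := t) (by rw [abs_of_pos (by linarith)]; linarith),
        zero_mul]
  rw [integral_Icc_eq_integral_Ioc, ← intervalIntegral.integral_of_le (by linarith)]
  have hderiv : ∀ x ∈ uIcc (u - θ * Real.cot θ) (θ * Real.cot θ),
      HasDerivAt (fun y ↦ (y / 2 * Real.cos (u * Real.tan θ)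
          + Real.sin ((2 * y - u) * Real.tan θ) / (4 * Real.tan θ)
          - Real.cos θ * Real.sin (y * Real.tan θ) / Real.tan θ
          + Real.cos θ * Real.sin ((u - y) * Real.tan θ) / Real.tan θ
          + Real.cos θ ^ 2 * y) / Real.cos θ ^ 4)
        (fordKernelG θ x * fordKernelG θ (u - x)) x := by
    intro x hx
    rw [uIcc_of_le (by linarith), mem_Icc] at hx
    have hx1 : |x| ≤ θ * Real.cot θ := abs_le.2 ⟨by linarith, hx.2⟩
    have hx2 : |u - x| ≤ θ * Real.cot θ := abs_le.2 ⟨by linarith, by linarith⟩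
    have d1 := ((hasDerivAt_id' x).div_const 2).mul_const (Real.cos (u * Real.tan θ))
    have d2 := (((((hasDerivAt_id' x).const_mul 2).sub_const u).mul_const (Real.tan θ)).sin).div_const
      (4 * Real.tan θ)
    have d3 := (((hasDerivAt_mul_const (x := x) (Real.tan θ)).sin).const_mul (Real.cos θ)).div_const
      (Real.tan θ)
    have d4 := (((((hasDerivAt_id' x).const_sub u).mul_const (Real.tan θ)).sin).const_mul
      (Real.cos θ)).div_const (Real.tan θ)
    have d5 := hasDerivAt_const_mul (x := x) (Real.cos θ ^ 2)
    refine (((((d1.fun_add d2).fun_sub d3).fun_add d4).fun_add d5).div_const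
      (Real.cos θ ^ 4)).congr_deriv ?_
    have p1 : Real.cos (u * Real.tan θ) = Real.cos (x * Real.tan θ) * Real.cos ((u - x) * Real.tan θ)
        - Real.sin (x * Real.tan θ) * Real.sin ((u - x) * Real.tan θ) := by
      rw [← Real.cos_add]; congr 1; ring
    have p2 : Real.cos ((2 * x - u) * Real.tan θ)
        = Real.cos (x * Real.tan θ) * Real.cos ((u - x) * Real.tan θ)
          + Real.sin (x * Real.tan θ) * Real.sin ((u - x) * Real.tan θ) := by
      rw [← Real.cos_sub]; congr 1; ring
    rw [p1, p2, fordKernelG_of_abs_le hx1, fordKernelG_of_abs_le hx2]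
    field_simp
    ring
  rw [intervalIntegral.integral_eq_sub_of_hasDerivAt hderiv
      ((hcont.mul (hcont.comp (continuous_const.sub continuous_id))).intervalIntegrable _ _)]
  -- evaluate the antiderivative at the endpoints
  have r1 : Real.sin ((2 * (θ * Real.cot θ) - u) * Real.tan θ)
      = Real.sin (2 * θ) * Real.cos (u * Real.tan θ) - Real.cos (2 * θ) * Real.sin (u * Real.tan θ) := by
    rw [show (2 * (θ * Real.cot θ) - u) * Real.tan θ = 2 * θ - u * Real.tan θ by
      linear_combination 2 * haT, Real.sin_sub]
  have r2 : Real.sin (θ * Real.cot θ * Real.tan θ) = Real.sin θ := by rw [haT]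
  have r3 : Real.sin ((u - θ * Real.cot θ) * Real.tan θ)
      = Real.sin (u * Real.tan θ) * Real.cos θ - Real.cos (u * Real.tan θ) * Real.sin θ := by
    rw [show (u - θ * Real.cot θ) * Real.tan θ = u * Real.tan θ - θ by
      linear_combination (-1) * haT, Real.sin_sub]
  have r4 : Real.sin ((2 * (u - θ * Real.cot θ) - u) * Real.tan θ)
      = -(Real.sin (2 * θ) * Real.cos (u * Real.tan θ) - Real.cos (2 * θ) * Real.sin (u * Real.tan θ)) := by
    rw [show (2 * (u - θ * Real.cot θ) - u) * Real.tan θ = -(2 * θ - u * Real.tan θ) by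
      linear_combination (-2) * haT, Real.sin_neg, Real.sin_sub]
  have r5 : Real.sin ((u - (u - θ * Real.cot θ)) * Real.tan θ) = Real.sin θ := by
    rw [show (u - (u - θ * Real.cot θ)) * Real.tan θ = θ by linear_combination haT]
  simp only [r1, r2, r3, r4, r5]
  rw [Real.sin_two_mul, Real.cos_two_mul]
  rw [Real.tan_eq_sin_div_cos] at hT ⊢
  rw [Real.cot_eq_cos_div_sin]
  field_simp
  ring

omit hθ₀ hθ₁ in
/-- `w` is supported in `[−2θ cot θ, 2θ cot θ]`. [folklore] -/
theorem fordKernelW_eq_zero {u : ℝ} (hu : 2 * (θ * Real.cot θ) < |u|) : fordKernelW θ u = 0 := by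
  have hsub : Function.support (fordKernelW θ)
      ⊆ Icc (-(θ * Real.cot θ) + -(θ * Real.cot θ)) (θ * Real.cot θ + θ * Real.cot θ) :=
    (support_convolution_subset _).trans
      ((Set.add_subset_add support_fordKernelG_subset support_fordKernelG_subset).trans
        (Set.Icc_add_Icc_subset _ _ _ _))
  by_contra h
  have := hsub (Function.mem_support.2 h)
  rw [mem_Icc] at this
  have : |u| ≤ 2 * (θ * Real.cot θ) := abs_le.2 ⟨by linarith [this.1], by linarith [this.2]⟩
  linarith

end explicit

/-! ### `W(−1)` in closed form (Ford 2002, (6.5)) -/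

/-- Product rule bookkeeping: the derivative of `e^y ((P₀ + P₁y) cos(yT) + (Q₀ + Q₁y) sin(yT) + R₀ + R₁y)/c`.
[folklore] -/
theorem hasDerivAt_exp_mul_trigPoly (T c4 P0 P1 Q0 Q1 R0 R1 x : ℝ) :
    HasDerivAt (fun y ↦ Real.exp y * (((P0 + P1 * y) * Real.cos (y * T)
        + (Q0 + Q1 * y) * Real.sin (y * T) + (R0 + R1 * y)) / c4))
      (Real.exp x * (((P0 + P1 + T * Q0 + (P1 + T * Q1) * x) * Real.cos (x * T)
        + (Q0 + Q1 - T * P0 + (Q1 - T * P1) * x) * Real.sin (x * T) + (R0 + R1 + R1 * x)) / c4)) x := by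
  have h1 := (((hasDerivAt_id' x).const_mul P1).const_add P0).fun_mul
    ((hasDerivAt_mul_const (x := x) T).cos)
  have h2 := (((hasDerivAt_id' x).const_mul Q1).const_add Q0).fun_mul
    ((hasDerivAt_mul_const (x := x) T).sin)
  have h3 := ((hasDerivAt_id' x).const_mul R1).const_add R0
  have h := (Real.hasDerivAt_exp x).fun_mul (((h1.fun_add h2).fun_add h3).div_const c4)
  refine h.congr_deriv ?_
  ring

section laplace

variable {θ : ℝ} (hθ₀ : 0 < θ) (hθ₁ : θ < π / 2)
include hθ₀ hθ₁

/-- **`W(−1)` in closed form**: `W(−1) = ∫₀^∞ e^u w(u) du = 1 + (2 − 3θ cot θ) sec²θ`, which is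
Ford's `2 tan²θ + 3 − 3θ(tan θ + cot θ)` (Ford 2002, (6.5)) rewritten with `sin²θ + cos²θ = 1`.
Obtained by integrating `e^u` against the explicit kernel (`fordKernelW_eq_explicit`) on
`[0, 2θ cot θ]`. [cite: Ford2002Millennium, (6.5)] -/
theorem fordLaplaceW_neg_one :
    fordLaplaceW θ (-1) = 1 + (2 - 3 * (θ * Real.cot θ)) / Real.cos θ ^ 2 := by
  have ha := ford_cot_pos hθ₀ hθ₁
  have hc := ford_cos_pos hθ₀ hθ₁
  have hs := ford_sin_pos hθ₀ hθ₁
  have hT := ford_tan_pos hθ₀ hθ₁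
  have haT : θ * Real.cot θ * Real.tan θ = θ := ford_cot_mul_tan hθ₀ hθ₁
  have hTsc : Real.tan θ = Real.sin θ / Real.cos θ := Real.tan_eq_sin_div_cos θ
  have hP : Real.sin θ ^ 2 + Real.cos θ ^ 2 = 1 := Real.sin_sq_add_cos_sq θ
  unfold fordLaplaceW
  simp only [neg_mul, one_mul, neg_neg]
  rw [setIntegral_eq_of_subset_of_forall_sdiff_eq_zero (s := Ioc 0 (2 * (θ * Real.cot θ)))
      measurableSet_Ioi Ioc_subset_Ioi_self ?_]
  swap
  · rintro x ⟨hx0, hx⟩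
    have hx' : 2 * (θ * Real.cot θ) < x := by
      by_contra h
      exact hx ⟨hx0, not_lt.1 h⟩
    rw [fordKernelW_eq_zero (θ := θ) (by rw [abs_of_pos (lt_trans (by positivity) hx')]; exact hx'),
      mul_zero]
  rw [← intervalIntegral.integral_of_le (by positivity)]
  rw [intervalIntegral.integral_congr (g := fun x ↦ Real.exp x * fordKernelWExplicit θ x) ?_]
  swap
  · intro x hx
    rw [uIcc_of_le (by positivity), mem_Icc] at hx
    simp only
    rw [fordKernelW_eq_explicit hθ₀ hθ₁ hx.1 hx.2]
  unfold fordKernelWExplicit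
  set S := Real.sin θ with hS
  set C := Real.cos θ with hC
  set Tn := Real.tan θ with hTn
  set a := θ * Real.cot θ with ha_def
  -- the antiderivative `Ψ(y) = e^y ((p₀ + p₁y) cos(yT) + (q₀ + q₁y) sin(yT) + r₀ + r₁y)/C⁴`
  obtain ⟨p1, hp1⟩ : ∃ p1 : ℝ, p1 = -C ^ 2 / 2 := ⟨_, rfl⟩
  obtain ⟨q1, hq1⟩ : ∃ q1 : ℝ, q1 = -(S * C) / 2 := ⟨_, rfl⟩
  obtain ⟨p0, hp0⟩ : ∃ p0 : ℝ, p0 = a * C ^ 2 - C ^ 4 - C ^ 2 := ⟨_, rfl⟩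
  obtain ⟨q0, hq0⟩ : ∃ q0 : ℝ, q0 = C * (C ^ 2 + 2 * a - 2 * a * C ^ 2 + 2 * C ^ 4) / (2 * S) :=
    ⟨_, rfl⟩
  obtain ⟨r1, hr1⟩ : ∃ r1 : ℝ, r1 = -C ^ 2 := ⟨_, rfl⟩
  obtain ⟨r0, hr0⟩ : ∃ r0 : ℝ, r0 = C ^ 2 * (2 * a - 1) := ⟨_, rfl⟩
  have e1 : Tn * q1 = -S ^ 2 / 2 := by rw [hq1, hTsc]; field_simp
  have e2 : Tn * p1 = -(S * C) / 2 := by rw [hp1, hTsc]; field_simp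
  have e3 : Tn * q0 = (C ^ 2 + 2 * a - 2 * a * C ^ 2 + 2 * C ^ 4) / 2 := by
    rw [hq0, hTsc]; field_simp
  have e4 : Tn * p0 = S * C * (a - C ^ 2 - 1) := by rw [hp0, hTsc]; field_simp
  have c1 : p1 + Tn * q1 = -1 / 2 := by linear_combination e1 + hp1 + (-(1:ℝ) / 2) * hP
  have c2 : p0 + p1 + Tn * q0 = a - C ^ 2 := by rw [e3, hp0, hp1]; ring
  have c3 : q1 - Tn * p1 = 0 := by rw [e2, hq1]; ring
  have c4 : q0 + q1 - Tn * p0 = C * (2 * C ^ 2 + 1) / (2 * S) := by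
    have key : q0 + q1 - Tn * p0 - C * (2 * C ^ 2 + 1) / (2 * S)
        = C * (1 + 2 * C ^ 2 - 2 * a) / (2 * S) * (S ^ 2 + C ^ 2 - 1) := by
      rw [e4, hq0, hq1]; field_simp; ring
    have : C * (1 + 2 * C ^ 2 - 2 * a) / (2 * S) * (S ^ 2 + C ^ 2 - 1) = 0 := by rw [hP]; ring
    linarith
  have hderiv : ∀ x ∈ uIcc (0 : ℝ) (2 * a),
      HasDerivAt (fun y ↦ Real.exp y * (((p0 + p1 * y) * Real.cos (y * Tn)
          + (q0 + q1 * y) * Real.sin (y * Tn) + (r0 + r1 * y)) / C ^ 4))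
        (Real.exp x * (((a - C ^ 2 - x / 2) * Real.cos (x * Tn)
          + C * (2 * C ^ 2 + 1) / (2 * S) * Real.sin (x * Tn) + C ^ 2 * (2 * a - 2 - x)) / C ^ 4)) x := by
    intro x _
    refine (hasDerivAt_exp_mul_trigPoly Tn (C ^ 4) p0 p1 q0 q1 r0 r1 x).congr_deriv ?_
    rw [c1, c2, c3, c4, hr0, hr1]
    ring
  rw [intervalIntegral.integral_eq_sub_of_hasDerivAt hderiv (by
    apply Continuous.intervalIntegrable; fun_prop)]
  -- evaluate: the value at `2a` vanishes, the value at `0` is `(p₀ + r₀)/C⁴`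
  have h2aT : 2 * a * Tn = 2 * θ := by linear_combination 2 * haT
  have hbr : (p0 + p1 * (2 * a)) * Real.cos (2 * a * Tn) + (q0 + q1 * (2 * a)) * Real.sin (2 * a * Tn)
      + (r0 + r1 * (2 * a)) = 0 := by
    rw [h2aT, Real.cos_two_mul, Real.sin_two_mul, ← hS, ← hC]
    have hq : q0 * (2 * S * C) = C ^ 2 * (C ^ 2 + 2 * a - 2 * a * C ^ 2 + 2 * C ^ 4) := by
      rw [hq0]; field_simp
    have key : (p0 + p1 * (2 * a)) * (2 * C ^ 2 - 1) + (q0 + q1 * (2 * a)) * (2 * S * C)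
        + (r0 + r1 * (2 * a)) = -2 * a * C ^ 2 * (S ^ 2 + C ^ 2 - 1) := by
      rw [hp0, hp1, hq1, hr0, hr1]
      linear_combination hq
    rw [key, hP]; ring
  simp only [mul_zero, zero_mul, add_zero, Real.cos_zero, Real.sin_zero, Real.exp_zero, mul_one,
    one_mul, hbr, zero_div, zero_sub]
  rw [hp0, hr0]
  field_simp
  ring

/-! ### The first moment `∫₀^∞ u w(u) du = −W'(0)` and formula (4.6) -/

omit hθ₀ hθ₁ in
/-- Product-rule bookkeeping: the derivative of
`((X₀ + X₁y + X₂y²) sin(yT) + (Y₀ + Y₁y + Y₂y²) cos(yT) + Z₂y² + Z₃y³)/c`. [folklore] -/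
theorem hasDerivAt_trigPoly₂ (T c4 X0 X1 X2 Y0 Y1 Y2 Z2 Z3 x : ℝ) :
    HasDerivAt (fun y ↦ ((X0 + X1 * y + X2 * y ^ 2) * Real.sin (y * T)
        + (Y0 + Y1 * y + Y2 * y ^ 2) * Real.cos (y * T) + (Z2 * y ^ 2 + Z3 * y ^ 3)) / c4)
      (((X1 + 2 * X2 * x - T * (Y0 + Y1 * x + Y2 * x ^ 2)) * Real.sin (x * T)
        + (Y1 + 2 * Y2 * x + T * (X0 + X1 * x + X2 * x ^ 2)) * Real.cos (x * T)
        + (2 * Z2 * x + 3 * Z3 * x ^ 2)) / c4) x := by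
  have hq : ∀ A B D : ℝ, HasDerivAt (fun y ↦ A + B * y + D * y ^ 2) (B + 2 * D * x) x := by
    intro A B D
    have := (((hasDerivAt_id' x).const_mul B).const_add A).fun_add
      ((hasDerivAt_pow 2 x).const_mul D)
    refine this.congr_deriv ?_
    norm_num
    ring
  have h1 := (hq X0 X1 X2).fun_mul ((hasDerivAt_mul_const (x := x) T).sin)
  have h2 := (hq Y0 Y1 Y2).fun_mul ((hasDerivAt_mul_const (x := x) T).cos)
  have h3 : HasDerivAt (fun y ↦ Z2 * y ^ 2 + Z3 * y ^ 3) (2 * Z2 * x + 3 * Z3 * x ^ 2) x := by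
    have := ((hasDerivAt_pow 2 x).const_mul Z2).fun_add ((hasDerivAt_pow 3 x).const_mul Z3)
    refine this.congr_deriv ?_
    norm_num
    ring
  refine (((h1.fun_add h2).fun_add h3).div_const c4).congr_deriv ?_
  ring

/-- **`∫₀^∞ u w(u) du = −W'(0)` with `W'(0)` given by (4.6)**:
`W'(0) = [csc θ (3(4θ² − 5) + θ(15 − 4θ²) cot θ) − 3θ sec θ]/(3 sin θ)` (Mossinghoff–Trudgian–Yang
(4.6), "via a direct substitution" in (4.5)). Here the first moment of the explicit kernel is
computed on `[0, 2θ cot θ]` and compared with (4.6) using `sin²θ + cos²θ = 1`.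
[cite: MossinghoffTrudgianYangRNT2024, (4.6)] -/
theorem fordKernelMoment_eq : fordKernelMoment θ = -fordLaplaceWDeriv0 θ := by
  have ha := ford_cot_pos hθ₀ hθ₁
  have hc := ford_cos_pos hθ₀ hθ₁
  have hs := ford_sin_pos hθ₀ hθ₁
  have hT := ford_tan_pos hθ₀ hθ₁
  have haT : θ * Real.cot θ * Real.tan θ = θ := ford_cot_mul_tan hθ₀ hθ₁
  have hTsc : Real.tan θ = Real.sin θ / Real.cos θ := Real.tan_eq_sin_div_cos θ
  have hcot : Real.cot θ = Real.cos θ / Real.sin θ := Real.cot_eq_cos_div_sin θ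
  have hP : Real.sin θ ^ 2 + Real.cos θ ^ 2 = 1 := Real.sin_sq_add_cos_sq θ
  unfold fordKernelMoment
  rw [setIntegral_eq_of_subset_of_forall_sdiff_eq_zero (s := Ioc 0 (2 * (θ * Real.cot θ)))
      measurableSet_Ioi Ioc_subset_Ioi_self ?_]
  swap
  · rintro x ⟨hx0, hx⟩
    have hx' : 2 * (θ * Real.cot θ) < x := by
      by_contra h
      exact hx ⟨hx0, not_lt.1 h⟩
    rw [fordKernelW_eq_zero (θ := θ) (by rw [abs_of_pos (lt_trans (by positivity) hx')]; exact hx'),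
      mul_zero]
  rw [← intervalIntegral.integral_of_le (by positivity)]
  rw [intervalIntegral.integral_congr (g := fun x ↦ x * fordKernelWExplicit θ x) ?_]
  swap
  · intro x hx
    rw [uIcc_of_le (by positivity), mem_Icc] at hx
    simp only
    rw [fordKernelW_eq_explicit hθ₀ hθ₁ hx.1 hx.2]
  unfold fordKernelWExplicit
  -- abbreviations (opaque)
  obtain ⟨a, ha_def⟩ : ∃ a : ℝ, a = θ * Real.cot θ := ⟨_, rfl⟩
  obtain ⟨Tn, hTn⟩ : ∃ T : ℝ, T = Real.tan θ := ⟨_, rfl⟩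
  rw [← ha_def, ← hTn]
  have hTsc' : Tn = Real.sin θ / Real.cos θ := by rw [hTn, hTsc]
  have ha' : a = θ * Real.cos θ / Real.sin θ := by rw [ha_def, hcot]; ring
  have haT' : a * Tn = θ := by rw [ha_def, hTn]; exact haT
  have ha0 : 0 < a := by rw [ha_def]; exact ha
  -- the antiderivative coefficients
  obtain ⟨x2, hx2⟩ : ∃ v : ℝ, v = -Real.cos θ / (2 * Real.sin θ) := ⟨_, rfl⟩
  obtain ⟨x1, hx1⟩ : ∃ v : ℝ, v = (a - Real.cos θ ^ 2) * Real.cos θ / Real.sin θ := ⟨_, rfl⟩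
  obtain ⟨x0, hx0⟩ : ∃ v : ℝ, v = (2 * Real.cos θ ^ 2 + 3) * Real.cos θ ^ 3 / (2 * Real.sin θ ^ 3) :=
    ⟨_, rfl⟩
  obtain ⟨y0, hy0⟩ : ∃ v : ℝ, v = (a - Real.cos θ ^ 2) * Real.cos θ ^ 2 / Real.sin θ ^ 2 := ⟨_, rfl⟩
  obtain ⟨y1, hy1⟩ : ∃ v : ℝ, v = -(2 * Real.cos θ ^ 2 + 3) * Real.cos θ ^ 2 / (2 * Real.sin θ ^ 2) :=
    ⟨_, rfl⟩
  obtain ⟨y2, hy2⟩ : ∃ v : ℝ, v = 0 := ⟨_, rfl⟩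
  obtain ⟨z2, hz2⟩ : ∃ v : ℝ, v = Real.cos θ ^ 2 * (a - 1) := ⟨_, rfl⟩
  obtain ⟨z3, hz3⟩ : ∃ v : ℝ, v = -Real.cos θ ^ 2 / 3 := ⟨_, rfl⟩
  have d1 : x1 - Tn * y0 = 0 := by rw [hx1, hy0, hTsc']; field_simp; ring
  have d2 : 2 * x2 - Tn * y1 = Real.cos θ * (2 * Real.cos θ ^ 2 + 1) / (2 * Real.sin θ) := by
    rw [hx2, hy1, hTsc']; field_simp; ring
  have d3 : Tn * y2 = 0 := by rw [hy2]; ring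
  have d4 : y1 + Tn * x0 = 0 := by rw [hy1, hx0, hTsc']; field_simp; ring
  have d5 : 2 * y2 + Tn * x1 = a - Real.cos θ ^ 2 := by rw [hy2, hx1, hTsc']; field_simp; ring
  have d6 : Tn * x2 = -1 / 2 := by rw [hx2, hTsc']; field_simp
  have hderiv : ∀ x ∈ uIcc (0 : ℝ) (2 * a),
      HasDerivAt (fun y ↦ ((x0 + x1 * y + x2 * y ^ 2) * Real.sin (y * Tn)
          + (y0 + y1 * y + y2 * y ^ 2) * Real.cos (y * Tn) + (z2 * y ^ 2 + z3 * y ^ 3)) / Real.cos θ ^ 4)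
        (x * (((a - Real.cos θ ^ 2 - x / 2) * Real.cos (x * Tn)
          + Real.cos θ * (2 * Real.cos θ ^ 2 + 1) / (2 * Real.sin θ) * Real.sin (x * Tn)
          + Real.cos θ ^ 2 * (2 * a - 2 - x)) / Real.cos θ ^ 4)) x := by
    intro x _
    refine (hasDerivAt_trigPoly₂ Tn (Real.cos θ ^ 4) x0 x1 x2 y0 y1 y2 z2 z3 x).congr_deriv ?_
    rw [hz2, hz3]
    linear_combination (Real.sin (x * Tn) / Real.cos θ ^ 4) * d1
      + (x * Real.sin (x * Tn) / Real.cos θ ^ 4) * d2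
      - (x ^ 2 * Real.sin (x * Tn) / Real.cos θ ^ 4) * d3
      + (Real.cos (x * Tn) / Real.cos θ ^ 4) * d4
      + (x * Real.cos (x * Tn) / Real.cos θ ^ 4) * d5
      + (x ^ 2 * Real.cos (x * Tn) / Real.cos θ ^ 4) * d6
  rw [intervalIntegral.integral_eq_sub_of_hasDerivAt hderiv (by
    apply Continuous.intervalIntegrable; fun_prop)]
  -- evaluate at `2a` (where `2a·tan θ = 2θ`) and at `0`
  have h2aT : 2 * a * Tn = 2 * θ := by linear_combination 2 * haT'
  have hR : fordLaplaceWDeriv0 θ = ((Real.sin θ)⁻¹ * (3 * (4 * θ ^ 2 - 5)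
      + θ * (15 - 4 * θ ^ 2) * (Real.cos θ / Real.sin θ)) - 3 * θ / Real.cos θ) / (3 * Real.sin θ) := by
    unfold fordLaplaceWDeriv0; rw [hcot]
  rw [hR]
  have key : ((x0 + x1 * (2 * a) + x2 * (2 * a) ^ 2) * (2 * Real.sin θ * Real.cos θ)
        + (y0 + y1 * (2 * a) + y2 * (2 * a) ^ 2) * (2 * Real.cos θ ^ 2 - 1)
        + (z2 * (2 * a) ^ 2 + z3 * (2 * a) ^ 3)) / Real.cos θ ^ 4 - y0 / Real.cos θ ^ 4
      - -(((Real.sin θ)⁻¹ * (3 * (4 * θ ^ 2 - 5) + θ * (15 - 4 * θ ^ 2) * (Real.cos θ / Real.sin θ))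
          - 3 * θ / Real.cos θ) / (3 * Real.sin θ))
      = -θ * (4 * Real.cos θ ^ 2 + 1) / (Real.sin θ ^ 3 * Real.cos θ)
          * (Real.sin θ ^ 2 + Real.cos θ ^ 2 - 1) := by
    rw [hx0, hx1, hx2, hy0, hy1, hy2, hz2, hz3, ha']
    field_simp
    ring
  calc _ = ((x0 + x1 * (2 * a) + x2 * (2 * a) ^ 2) * (2 * Real.sin θ * Real.cos θ)
        + (y0 + y1 * (2 * a) + y2 * (2 * a) ^ 2) * (2 * Real.cos θ ^ 2 - 1)
        + (z2 * (2 * a) ^ 2 + z3 * (2 * a) ^ 3)) / Real.cos θ ^ 4 - y0 / Real.cos θ ^ 4 := by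
          simp only [h2aT, Real.sin_two_mul, Real.cos_two_mul, mul_zero, zero_mul, Real.sin_zero,
            Real.cos_zero, add_zero, mul_one, zero_add, ne_eq, OfNat.ofNat_ne_zero,
            not_false_eq_true, zero_pow]
    _ = _ := by linear_combination key + (-θ * (4 * Real.cos θ ^ 2 + 1)
          / (Real.sin θ ^ 3 * Real.cos θ)) * hP

end laplace

/-! ## Lemma 6.1 from the zero-detector inequality (6.8)–(6.9) and the kernel identities -/

/-- The right-hand side of inequality (6.8) of the source with the sum `(cπ²λf(0) − 4D) Σ b_j N(jt, ½)`
dropped (by (6.9)), for the kernel of angle `θ`, a zero `β + it` and the parameter `λ`: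
`−b₁[F(1−β) − 0.3334π² f(0)(1−β)] + f(0)[b J(Kt+1) + 0.851 b₀] + b₀F(0)`
`+ D{b(1.8 + L₁/3 + 3.2357 L₁ + 5.316 L₂ + 16.134) + 1.8 b₀}`,
where `K = 40`, `(b₀, b₁, b) = (mtyB40 0, mtyB40 1, mtyB40Sum)` ((3.6)), `f(0) = λ w(0)` ((4.4)),
`F(z) = W(z/λ − 1)` (loc. cit., so `F(1 − β) = W((1−β)/λ − 1)` and `F(0) = W(−1)`),
`D = 1.0146 λ f(0)` (proof of Lemma 6.1: "the conditions of Lemma 4.2 are satisfied with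
`D = 1.0146λf(0)` and `η = 1/2`"), `L₁ = log(40t + 1)`, `L₂ = log log(40t + 1)`, `J = mtyJ` ((6.1)).
Here `w = fordKernelW θ` and `W = fordLaplaceW θ` are the kernel and its Laplace transform
themselves (not their closed forms). [cite: MossinghoffTrudgianYangRNT2024, §6, (6.8)–(6.9)] -/
def mtyDetectorRHS (θ β t lam : ℝ) : ℝ :=
  -mtyB40 1 * (fordLaplaceW θ ((1 - β) / lam - 1)
      - 0.3334 * π ^ 2 * (lam * fordKernelW θ 0) * (1 - β))
    + lam * fordKernelW θ 0 * (mtyB40Sum * mtyJ (40 * t + 1) + 0.851 * mtyB40 0)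
    + mtyB40 0 * fordLaplaceW θ (-1)
    + 1.0146 * lam * (lam * fordKernelW θ 0)
        * (mtyB40Sum * (1.8 + Real.log (40 * t + 1) / 3 + 3.2357 * Real.log (40 * t + 1)
            + 5.316 * Real.log (Real.log (40 * t + 1)) + 16.134) + 1.8 * mtyB40 0)

/-- `0.3334 π² b₁ ≤ 5.746` for `P₄₀` (the coefficient `5.746` of Lemma 6.1; true value `5.7453…`).
[cite: MossinghoffTrudgianYangRNT2024, Lemma 6.1] -/
theorem coeff_5746_mtyB40 : 0.3334 * π ^ 2 * mtyB40 1 ≤ 5.746 := by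
  have hb := mtyB40_one_near
  rw [abs_le] at hb
  have hπ := Real.pi_lt_d6
  have hπ0 := Real.pi_pos
  have h1 : mtyB40 1 ≤ 1.746001909149941 := by norm_num at hb ⊢; linarith
  have h2 : π ^ 2 ≤ 3.141593 ^ 2 := pow_le_pow_left₀ hπ0.le hπ.le 2
  calc 0.3334 * π ^ 2 * mtyB40 1 ≤ 0.3334 * 3.141593 ^ 2 * 1.746001909149941 :=
        mul_le_mul (by linarith) h1 (isNonnegTrigPoly_mtyB40.1 1) (by positivity)
    _ ≤ 5.746 := by norm_num

/-- The bookkeeping `D{b(1.8 + L₁/3 + 3.2357L₁ + 5.316L₂ + 16.134) + 1.8b₀} ≤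
D b (3.5691 L₁ + 5.316 L₂ + 18.439)` of the last step of the proof of Lemma 6.1 (`b₀ = 1`,
`1/3 + 3.2357 ≤ 3.5691`, `17.934 + 1.8/b ≤ 18.439` as `b = 3.5645…`), for `L₁ ≥ 0`.
[cite: MossinghoffTrudgianYangRNT2024, Lemma 6.1 (proof, last sentence)] -/
theorem detector_tail_le {L₁ L₂ : ℝ} (hL : 0 ≤ L₁) :
    mtyB40Sum * (1.8 + L₁ / 3 + 3.2357 * L₁ + 5.316 * L₂ + 16.134) + 1.8 * 1
      ≤ mtyB40Sum * (3.5691 * L₁ + 5.316 * L₂ + 18.439) := by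
  have hb := mtyB40_sum_near
  rw [abs_le] at hb
  have hblo : 3.564539654371339 ≤ mtyB40Sum := by unfold mtyB40Sum; linarith [hb.1]
  have h1 : 0 ≤ mtyB40Sum * L₁ := mul_nonneg (by linarith) hL
  nlinarith

/-- **The kernel identity (6.10)**: `b₁ W(0) − b₀ W(−1) = b₀ w(0) cos²θ` for every solution `θ`
of (4.1) (this is how the angle `θ` enters: Ford 2002, (7.12); MTY (6.10), whose last term is
`b₀ f(0) cos²θ/λ = b₀ w(0) cos²θ` by `f(0) = λ w(0)`), from the closed forms of `W(0)`, `W(−1)`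
and `w(0)` proved above. [cite: MossinghoffTrudgianYangRNT2024, (6.10)]
[cite: Ford2002Millennium, (6.5) and (7.12)] -/
theorem ford_W_identity {b₀ b₁ θ : ℝ} (hθ : IsFordTheta b₀ b₁ θ) (hb₀ : b₀ ≠ 0) :
    b₁ * fordLaplaceW θ 0 - b₀ * fordLaplaceW θ (-1) = b₀ * fordSmoothW0 θ * Real.cos θ ^ 2 := by
  obtain ⟨hθ0, hθ1, heq⟩ := hθ
  have hc := ford_cos_pos hθ0 hθ1
  have hs := ford_sin_pos hθ0 hθ1
  have hP : Real.sin θ ^ 2 + Real.cos θ ^ 2 = 1 := Real.sin_sq_add_cos_sq θ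
  have hr : b₁ * (1 - θ * Real.cot θ) = b₀ * Real.sin θ ^ 2 := by
    rw [heq]; field_simp
  rw [fordLaplaceW_zero hθ0 hθ1, fordLaplaceW_neg_one hθ0 hθ1]
  unfold fordSmoothW0
  have e : b₁ * (2 * (1 - θ * Real.cot θ) ^ 2 / Real.cos θ ^ 2)
      = 2 * (b₁ * (1 - θ * Real.cot θ)) * (1 - θ * Real.cot θ) / Real.cos θ ^ 2 := by ring
  rw [e, hr, Real.tan_eq_sin_div_cos, Real.cot_eq_cos_div_sin]
  linear_combination (norm := skip)
    (b₀ * (2 * Real.sin θ - 3 * θ * Real.cos θ) / (Real.sin θ * Real.cos θ ^ 2)) * hP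
  field_simp
  ring

/-- **Lemma 6.1 of Mossinghoff–Trudgian–Yang from its zero-detector core.** For a solution
`θ ∈ [1.13331020, 1.13331021]` of (4.1) for `P₄₀` (it exists: `VK.exists_isFordTheta_mtyB40`;
the source's `θ = 1.13331020636698…`, (4.2)), ASSUME inequality (6.8) of the source with its sum
over `N(jt, ½)` dropped by (6.9) (`hZ`; this is the ζ-analytic core of the printed proof: Lemma 4.2
= Ford's mollified zero detector at `η = 1/2` summed against `P₄₀`, Patel's bound (3.3) through
Lemma 4.3, the `3/2`-line bound `0.851 b₀`, the far-zero bound (6.4) and the near-zero bounds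
(6.5)–(6.7)). THEN the conclusion of Lemma 6.1 holds, by the source's final steps (6.10)–(6.11)
and its roundings, all proved here: `b₁W(0) − b₀W(−1) = b₀f(0)cos²θ/λ` (`ford_W_identity`, from
the closed forms of `W(0)`, `W(−1)`, `w(0)`), `W(0) − W(X) ≤ X|W'(0)|` (`fordLaplaceW_zero_sub_le`,
`fordKernelMoment_eq`), division by `b₀ f(0) = λ w(0) > 0`, and `cos²θ ≥ 0.17949`,
`|W'(0)|b₁/(w(0)b₀) ≤ 0.20466`, `0.3334π²b₁/b₀ ≤ 5.746`, `1/3 + 3.2357 ≤ 3.5691`,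
`17.934 + 1.8b₀/b ≤ 18.439`. [cite: MossinghoffTrudgianYangRNT2024, Lemma 6.1 (proof: (6.8)–(6.11))] -/
theorem zero_inequality_intermediate_of_detector {θ : ℝ}
    (hθ : IsFordTheta (mtyB40 0) (mtyB40 1) θ) (hθ1 : 1.13331020 ≤ θ) (hθ2 : θ ≤ 1.13331021)
    (hZ : ∀ β t : ℝ, Real.exp 1000 ≤ t → riemannZeta (β + t * Complex.I) = 0 → 1 - 1 / 1712 ≤ β →
      ∀ lam : ℝ, 0 < lam → lam ≤ 1 - β → ZetaZeroFreeRect lam t (40 * t + 1) →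
        0 ≤ mtyDetectorRHS θ β t lam) :
    zero_inequality_intermediate_mossinghoff_trudgian_yang := by
  intro β t ht hz hβ lam hl0 hl1 hrect
  have h0 := hZ β t ht hz hβ lam hl0 hl1 hrect
  obtain ⟨hθ0, hθpi, heq⟩ := hθ
  -- certified numerics on the θ-interval
  have hw : 5.6453 ≤ fordSmoothW0 θ := VK.fordSmoothW0_ge hθ1 hθ2
  have hcos : 0.17949 ≤ Real.cos θ ^ 2 := VK.cos_sq_ge_of_mem_thetaIcc hθ1 hθ2
  have hratio := VK.wDeriv_ratio_mtyB40_le hθ1 hθ2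
  have hWd := VK.fordLaplaceWDeriv0_mem hθ1 hθ2
  have hb1nn : 0 ≤ mtyB40 1 := isNonnegTrigPoly_mtyB40.1 1
  have h5746 := coeff_5746_mtyB40
  -- kernel facts (all proved above)
  have hid := ford_W_identity ⟨hθ0, hθpi, heq⟩ (by rw [mtyB40_zero]; norm_num)
  have hconv := fordLaplaceW_zero_sub_le hθ0 hθpi ((1 - β) / lam - 1)
  rw [fordKernelMoment_eq hθ0 hθpi] at hconv
  have hw0 : fordKernelW θ 0 = fordSmoothW0 θ := fordKernelW_zero hθ0 hθpi
  -- elementary signs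
  have ht0 : 0 < t := lt_of_lt_of_le (Real.exp_pos _) ht
  have hL1 : 0 ≤ Real.log (40 * t + 1) := Real.log_nonneg (by linarith)
  have hX0 : 0 ≤ (1 - β) / lam - 1 := by
    rw [sub_nonneg, le_div_iff₀ hl0]; linarith
  have hβ1 : 0 ≤ 1 - β := by linarith
  have htail := detector_tail_le (L₂ := Real.log (Real.log (40 * t + 1))) hL1
  -- normalise `b₀ = 1`, `w(0)`, `|W'(0)|`
  unfold mtyDetectorRHS at h0
  rw [hw0, mtyB40_zero] at h0
  rw [mtyB40_zero] at hid hratio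
  rw [abs_of_nonpos hWd.2, mul_one] at hratio
  rw [mtyB40_zero, div_one]
  have hw0pos : 0 < fordSmoothW0 θ := by linarith
  have hmb : -fordLaplaceWDeriv0 θ * mtyB40 1 ≤ 0.20466 * fordSmoothW0 θ := by
    rwa [div_le_iff₀ hw0pos] at hratio
  -- make the kernel quantities atoms
  generalize fordLaplaceW θ 0 = W0 at hid hconv
  generalize fordLaplaceW θ ((1 - β) / lam - 1) = WX at h0 hconv
  generalize fordLaplaceW θ (-1) = Wm at h0 hid
  generalize fordSmoothW0 θ = w0 at h0 hid hw hmb hw0pos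
  generalize -fordLaplaceWDeriv0 θ = m at hconv hmb
  generalize Real.cos θ ^ 2 = c2 at hid hcos
  generalize (1 - β) / lam - 1 = X at h0 hconv hX0 ⊢
  generalize Real.log (40 * t + 1) = L₁ at h0 hL1 htail ⊢
  generalize Real.log L₁ = L₂ at h0 htail ⊢
  generalize mtyJ (40 * t + 1) = J at h0 ⊢
  generalize mtyB40 1 = b₁ at h0 hid hb1nn h5746 hmb
  generalize mtyB40Sum = b at h0 htail ⊢
  -- the tail sum `S` of the right-hand side
  have h1 := mul_le_mul_of_nonneg_left hconv hb1nn
  have hkey : w0 * c2 - b₁ * (X * m) ≤ lam * w0 * (0.3334 * π ^ 2 * b₁ * (1 - β) + b * J + 0.851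
      + 1.0146 * lam * (b * (1.8 + L₁ / 3 + 3.2357 * L₁ + 5.316 * L₂ + 16.134) + 1.8 * 1)) := by
    linarith
  have h2 : X * (m * b₁) ≤ X * (0.20466 * w0) := mul_le_mul_of_nonneg_left hmb hX0
  have h3 : w0 * (c2 - 0.20466 * X - lam * (0.3334 * π ^ 2 * b₁ * (1 - β) + b * J + 0.851
      + 1.0146 * lam * (b * (1.8 + L₁ / 3 + 3.2357 * L₁ + 5.316 * L₂ + 16.134) + 1.8 * 1))) ≤ 0 := by
    linarith
  have h4 : c2 - 0.20466 * X - lam * (0.3334 * π ^ 2 * b₁ * (1 - β) + b * J + 0.851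
      + 1.0146 * lam * (b * (1.8 + L₁ / 3 + 3.2357 * L₁ + 5.316 * L₂ + 16.134) + 1.8 * 1)) ≤ 0 := by
    by_contra hcon
    push Not at hcon
    linarith [mul_pos hw0pos hcon]
  have hS : 0.3334 * π ^ 2 * b₁ * (1 - β) + b * J + 0.851
      + 1.0146 * lam * (b * (1.8 + L₁ / 3 + 3.2357 * L₁ + 5.316 * L₂ + 16.134) + 1.8 * 1)
      ≤ 5.746 * (1 - β) + b * J + 0.851 + 1.0146 * lam * b * (3.5691 * L₁ + 5.316 * L₂ + 18.439) := by
    have e1 : 0.3334 * π ^ 2 * b₁ * (1 - β) ≤ 5.746 * (1 - β) :=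
      mul_le_mul_of_nonneg_right h5746 hβ1
    have e2 : 1.0146 * lam * (b * (1.8 + L₁ / 3 + 3.2357 * L₁ + 5.316 * L₂ + 16.134) + 1.8 * 1)
        ≤ 1.0146 * lam * (b * (3.5691 * L₁ + 5.316 * L₂ + 18.439)) :=
      mul_le_mul_of_nonneg_left htail (by positivity)
    linarith
  have hS' := mul_le_mul_of_nonneg_left hS hl0.le
  rw [one_div, inv_mul_le_iff₀ hl0]
  linarith

/-- **Lemma 6.1 from its zero-detector core, quantified form**: if the detector inequality
(6.8)–(6.9) holds for every solution `θ` of (4.1) for `P₄₀`, then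
`zero_inequality_intermediate_mossinghoff_trudgian_yang`; the solution `θ` (and its enclosure) is
supplied by `VK.exists_isFordTheta_mtyB40`, everything about the kernel is proved in this file.
[cite: MossinghoffTrudgianYangRNT2024, Lemma 6.1] -/
theorem zero_inequality_intermediate_of_detector'
    (hZ : ∀ θ : ℝ, IsFordTheta (mtyB40 0) (mtyB40 1) θ →
      ∀ β t : ℝ, Real.exp 1000 ≤ t → riemannZeta (β + t * Complex.I) = 0 → 1 - 1 / 1712 ≤ β →
      ∀ lam : ℝ, 0 < lam → lam ≤ 1 - β → ZetaZeroFreeRect lam t (40 * t + 1) →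
        0 ≤ mtyDetectorRHS θ β t lam) :
    zero_inequality_intermediate_mossinghoff_trudgian_yang := by
  obtain ⟨θ, hθ, h1, h2⟩ := VK.exists_isFordTheta_mtyB40
  exact zero_inequality_intermediate_of_detector hθ h1 h2 (hZ θ hθ)

end Literature.NumberTheory.LFunctions
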